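import Summits.NavierStokesRegularity.NavierStokesRegularity.Theorems.TaoLadderRungTwoFlatReachClosure
import Summits.NavierStokesRegularity.NavierStokesRegularity.Theorems.TaoLadderRungTwoFlatGappedFrontRobustTailEnergyOn
import Summits.NavierStokesRegularity.NavierStokesRegularity.Theorems.TaoLadderRungTwoFlatMirrorTableDefs
import HarnessLib

/-!
# `RobustHoppingOn` is refutable by ADVERSARIAL DEFLATION (cell harvest/h2-tao-ladder, theory-1 g38, numT50; cell file numT50/ReachDeflation50.lean sha16
79644cb023cb3b75, landed verbatim by p1 g21 as `…Theorems.TaoLadderRungTwoFlatReachDeflation`)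

Helper-level NEGATIVE lemma about the packaging predicate `ReachClosure.RobustHoppingOn` (p681515, lemma «L7» of the analytic lane of child 2 = item stmt-
NavierStokesRegularity-23909 `GradedAdiabaticWake` of route TaoLadderRungTwoFlat). It is NOT about any route item: `FlatGapCertificatesV2`,
`GradedAdiabaticWake` and the certificate format `GapData₂On` quantify `∃ Z` (the prover DESCRIBES the reference set), and are untouched.

THE POINT. `Reach` closes the reference set under EVERY legal checkpoint `(τ₁, a)`, not under a canonical one. If from every reachable state some legal SLACK
step exists (`(1+σ)·a ≤ |S i₀ 1 τ₁|`, `a ≥ (1+ε₀)^{-θ₀}`), then the FULL DEFLATION `a' := |S i₀ 1 τ₁|` is also legal, and re-centring by `a'` divides every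
partial energy sum by `a'^2 ≥ q^2`, `q := (1+σ)(1+ε₀)^{-θ₀}`, while the re-centred state has `z' i₀ 0 ^ 2 = 1`. Iterating from the datum (finite energy `Ē`)
gives reachable states with `1 ≤ Ē / q^{2N}` for every `N` — impossible when `q > 1`, i.e. whenever `(1+ε₀)^{θ₀} < 1 + σ` (every fixed `σ > 0` and all small
`ε₀`; the cell's constants `σ = θ₀ = 1/4` always). The only analytic input is ENERGY NON-INCREASE along exact format flows (`ExactEnergyNonincreasingOn`),
PROVED below for cancelling tables on nearest-neighbour slot-closed shift sets at `ε₀ > 0` from the landed tail-energy cap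
(`GappedFrontRobustOn.pseudoFlowOnShift_tail_energy_le`) and the a-priori amplitude bound (the bottom flux vanishes as the bond recedes):
`exactEnergyNonincreasingOn_of_cancelling`; hence the UNCONDITIONAL `not_robustHoppingOn_mirror_flat` (graded mirror table on `S♭`, `(1+ε₀)^{θ₀} < 1+σ`) and
`not_robustHoppingOn_mirror_flat_cell` (`σ = θ₀ = 1/4`, `0 < ε₀ ≤ 1`).

CONSEQUENCE FOR THE LANE: the assembly of child 2 must go through `GapData₂On` with a DESCRIBED tube `Z` and the prover's OWN canonical re-centring
(`TubeHoppingOn` below, `ρ = 0`), never through `reachSet`.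

HONEST FRAMING: MODEL-lattice certificate vocabulary (Tao 2016 §6 shape, cell format v2); a packaging lemma and a negative lemma about a helper predicate;
nothing certified; nothing about the Navier–Stokes equations.
-/

noncomputable section
set_option linter.dupNamespace false

namespace Summit.NavierStokesRegularity.NavierStokesRegularity.Theorems.ReachClosure

open Set Finset Literature.Analysis.FluidPDE Literature.Analysis.FluidPDE.TaoCascade

variable {m : ℕ}

/-- «All partial sums of the squared amplitudes of the state `z` are at most `B`» (twice the energy; finset form, no summability bookkeeping). [cite:
Tao2016AveragedNS, §4 (4.3) energy identity; cell certificate format v2] -/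
def EnergyLe (z : Fin m → ℤ → ℝ) (B : ℝ) : Prop :=
  ∀ s : Finset (Fin m × ℤ), ∑ p ∈ s, z p.1 p.2 ^ 2 ≤ B

/-- **L-E (named analytic input).** Along every EXACT format flow on `𝕊` (defect constants `0`, start energies `½ S₀²`, no slack) a bound on all partial sums of
`S₀²` persists on `[0, τ]`. True for cancelling tables on a nearest-neighbour slot-closed `𝕊` at `ε₀ > 0` (energy above a bond is fed only through that bond,
and the bottom flux vanishes as the bond recedes: `pseudoFlowOnShift_tail_energy_le` + the a-priori amplitude bound); stated here as a hypothesis. [cite: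
Tao2016AveragedNS, §4 Lemma 4.1 (4.5), (4.9) with (4.3)] -/
def ExactEnergyNonincreasingOn (𝕊 : Finset (ℤ × ℤ × ℤ)) (ε₀ : ℝ)
    (α : Fin m → Fin m → Fin m → ℤ × ℤ × ℤ → ℝ) : Prop :=
  ∀ (τ B : ℝ) (S₀ : Fin m → ℤ → ℝ) (S F : Fin m → ℤ → ℝ → ℝ), EnergyLe S₀ B →
    PseudoFlowOnShift 𝕊 τ ε₀ α 0 0 S₀ (fun i k => (1 / 2) * S₀ i k ^ 2) (fun _ _ => 0) S F →
      ∀ s ∈ Icc 0 τ, EnergyLe (fun i k => S i k s) B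

/-- The normalised datum has all partial energy sums bounded by its (finite) level-`0` sum. [cite: Tao2016AveragedNS, §6.4 (normalised restart datum); cell
certificate format v2] -/
theorem energyLe_datumState (i₀ : Fin m) (X₀ : Fin m → ℝ) :
    EnergyLe (datumState i₀ X₀)
      (∑ p ∈ (Finset.univ : Finset (Fin m)) ×ˢ ({0} : Finset ℤ), datumState i₀ X₀ p.1 p.2 ^ 2) := by
  intro s
  have hzero : ∀ x ∈ s ∪ (Finset.univ : Finset (Fin m)) ×ˢ ({0} : Finset ℤ),
      x ∉ (Finset.univ : Finset (Fin m)) ×ˢ ({0} : Finset ℤ) → datumState i₀ X₀ x.1 x.2 ^ 2 = 0 := by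
    intro x _ hx
    have hx2 : x.2 ≠ 0 := by
      intro h0
      exact hx (Finset.mem_product.mpr ⟨Finset.mem_univ _, Finset.mem_singleton.mpr h0⟩)
    simp [datumState, hx2]
  calc ∑ p ∈ s, datumState i₀ X₀ p.1 p.2 ^ 2
      ≤ ∑ p ∈ s ∪ (Finset.univ : Finset (Fin m)) ×ˢ ({0} : Finset ℤ), datumState i₀ X₀ p.1 p.2 ^ 2 :=
        Finset.sum_le_sum_of_subset_of_nonneg Finset.subset_union_left (fun _ _ _ => sq_nonneg _)
    _ = ∑ p ∈ (Finset.univ : Finset (Fin m)) ×ˢ ({0} : Finset ℤ), datumState i₀ X₀ p.1 p.2 ^ 2 :=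
        (Finset.sum_subset Finset.subset_union_right hzero).symm

/-- The index shift `(i, k) ↦ (i, 1 + k)` as an embedding (re-centring one shell up). [cite: Tao2016AveragedNS, §6.4 (re-centring at a checkpoint); cell certificate
format v2] -/
def shiftEmb (m : ℕ) : (Fin m × ℤ) ↪ (Fin m × ℤ) :=
  ⟨fun p => (p.1, 1 + p.2), by
    intro p q h
    simp only [Prod.mk.injEq, add_right_inj] at h
    exact Prod.ext h.1 h.2⟩

/-- Re-centring `z' i k := S i (1+k) τ₁ / a'` divides every partial energy sum by `a'^2`. [cite: Tao2016AveragedNS, §6.4 (re-centring at a checkpoint); cell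
certificate format v2] -/
theorem energyLe_recentre {Sτ : Fin m → ℤ → ℝ} {B a' q : ℝ} (hB : EnergyLe Sτ B) (hq : 0 < q)
    (ha' : q ≤ a') : EnergyLe (fun i k => Sτ i (1 + k) / a') (B / q ^ 2) := by
  intro s
  have hB0 : 0 ≤ B := by simpa using hB ∅
  have ha'0 : 0 < a' := hq.trans_le ha'
  have hsum : ∑ p ∈ s, (Sτ p.1 (1 + p.2) / a') ^ 2 = (∑ p ∈ s.map (shiftEmb m), Sτ p.1 p.2 ^ 2) / a' ^ 2 := by
    rw [Finset.sum_map, Finset.sum_div]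
    refine Finset.sum_congr rfl fun p _ => ?_
    simp [shiftEmb, div_pow]
  rw [hsum]
  calc (∑ p ∈ s.map (shiftEmb m), Sτ p.1 p.2 ^ 2) / a' ^ 2 ≤ B / a' ^ 2 :=
        div_le_div_of_nonneg_right (hB _) (by positivity)
    _ ≤ B / q ^ 2 := by
        apply div_le_div_of_nonneg_left hB0 (by positivity)
        exact pow_le_pow_left₀ hq.le ha' 2

/-- **ONE ADVERSARIAL DEFLATION HOP.** Under `RobustHoppingOn`, from every reachable state with partial energy sums `≤ B` there is a reachable state with `z' i₀ 0 ^
2 = 1` and partial energy sums `≤ B / q^2`, `q = (1+σ)(1+ε₀)^{-θ₀}` (given energy non-increase along exact flows). [cite: Tao2016AveragedNS, §6.4 Prop. 6.5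
(statement shape of the checkpoint step); cell certificate format v2] -/
theorem RobustHoppingOn.deflate {𝕊 : Finset (ℤ × ℤ × ℤ)} {σ ε₀ : ℝ} {i₀ : Fin m}
    {α : Fin m → Fin m → Fin m → ℤ × ℤ × ℤ → ℝ} {X₀ : Fin m → ℝ} {w : ℤ → ℝ} {r θ₀ θ c₀ c : ℝ}
    {env₀ : ℤ → ℝ} (h : RobustHoppingOn 𝕊 σ ε₀ i₀ α X₀ w r θ₀ θ c₀ c env₀)
    (hE : ExactEnergyNonincreasingOn 𝕊 ε₀ α) (hq : 1 < (1 + σ) * (1 + ε₀) ^ (-θ₀))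
    {z : Fin m → ℤ → ℝ} (hz : z ∈ reachSet 𝕊 ε₀ i₀ α X₀ w r θ₀ c₀ env₀) {B : ℝ} (hzB : EnergyLe z B) :
    ∃ z' ∈ reachSet 𝕊 ε₀ i₀ α X₀ w r θ₀ c₀ env₀,
      z' i₀ 0 ^ 2 = 1 ∧ EnergyLe z' (B / ((1 + σ) * (1 + ε₀) ^ (-θ₀)) ^ 2) := by
  obtain ⟨hr, -, -, -, -, hc, hσ, -, -, -, -, hexist, hstep⟩ := h
  set q : ℝ := (1 + σ) * (1 + ε₀) ^ (-θ₀) with hq_def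
  have hq0 : 0 < q := one_pos.trans hq
  -- the trivial kick: `z` is within weighted distance `r` of itself
  have hkick : ∀ i k, w k * |z i k - z i k| ≤ r := fun i k => by simp [hr.le]
  have hball : ballDesc (reachSet 𝕊 ε₀ i₀ α X₀ w r θ₀ c₀ env₀) w r z (fun i k => (1 / 2) * z i k ^ 2) :=
    ⟨z, hz, hkick⟩
  obtain ⟨S, F, hflow⟩ := hexist z hball
  obtain ⟨τ₁, a, hcore, hslack⟩ := hstep z c S F hball hc.le hflow
  obtain ⟨h1, h2, h3, h4, h5, -, h7⟩ := hcore
  -- the adversarial (fully deflating) ratio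
  set a' : ℝ := |S i₀ 1 τ₁| with ha'_def
  have haq : q ≤ a' := by
    have : (1 + σ) * (1 + ε₀) ^ (-θ₀) ≤ (1 + σ) * a := mul_le_mul_of_nonneg_left h4 (by linarith)
    exact this.trans hslack
  have ha'0 : 0 < a' := hq0.trans_le haq
  have hfloor : (1 + ε₀) ^ (-θ₀) ≤ a' := by
    have : a ≤ (1 + σ) * a := le_mul_of_one_le_left h3.le (by linarith)
    exact h4.trans (this.trans hslack)
  have hcore' : StepCore ε₀ θ₀ c₀ i₀ env₀ S F τ₁ a' := ⟨h1, h2, ha'0, hfloor, le_rfl, trivial, h7⟩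
  refine ⟨fun i k => S i (1 + k) τ₁ / a', Reach.hop hz hkick hc.le hflow hcore', ?_, ?_⟩
  · have hne : S i₀ 1 τ₁ ≠ 0 := by
      intro h0
      simp [ha'_def, h0] at ha'0
    simp only [add_zero, div_pow, ha'_def, sq_abs]
    exact div_self (pow_ne_zero 2 hne)
  · have hτ₁ : τ₁ ∈ Icc 0 c := ⟨h1.le, h2.trans hc.le⟩
    have hSB : EnergyLe (fun i k => S i k τ₁) B := hE c B z S F hzB hflow τ₁ hτ₁
    simpa [hq_def] using energyLe_recentre (Sτ := fun i k => S i k τ₁) hSB hq0 haq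

/-- **`RobustHoppingOn` IS REFUTABLE BY DEFLATION.** If exact format flows on `𝕊` do not increase energy and `(1+σ)(1+ε₀)^{-θ₀} > 1`, then `RobustHoppingOn 𝕊 σ ε₀
i₀ α X₀ w r θ₀ θ c₀ c env₀` is false — for every datum, weights, radius, clocks and envelope. [cite: Tao2016AveragedNS, §6.4 Prop. 6.5 (statement shape of the
checkpoint step); cell certificate format v2] -/
theorem not_robustHoppingOn_of_deflation {𝕊 : Finset (ℤ × ℤ × ℤ)} {σ ε₀ : ℝ} {i₀ : Fin m}
    {α : Fin m → Fin m → Fin m → ℤ × ℤ × ℤ → ℝ} {X₀ : Fin m → ℝ} {w : ℤ → ℝ} {r θ₀ θ c₀ c : ℝ}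
    {env₀ : ℤ → ℝ} (hE : ExactEnergyNonincreasingOn 𝕊 ε₀ α) (hq : 1 < (1 + σ) * (1 + ε₀) ^ (-θ₀)) :
    ¬ RobustHoppingOn 𝕊 σ ε₀ i₀ α X₀ w r θ₀ θ c₀ c env₀ := by
  intro h
  set q : ℝ := (1 + σ) * (1 + ε₀) ^ (-θ₀) with hq_def
  have hq0 : 0 < q := one_pos.trans hq
  have hq2 : 1 < q ^ 2 := one_lt_pow₀ hq two_ne_zero
  set Ē : ℝ := ∑ p ∈ (Finset.univ : Finset (Fin m)) ×ˢ ({0} : Finset ℤ), datumState i₀ X₀ p.1 p.2 ^ 2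
    with hĒ_def
  -- iterate the deflation hop from the datum
  have key : ∀ N : ℕ, ∃ z ∈ reachSet 𝕊 ε₀ i₀ α X₀ w r θ₀ c₀ env₀, EnergyLe z (Ē / (q ^ 2) ^ N) := by
    intro N
    induction N with
    | zero => exact ⟨datumState i₀ X₀, Reach.datum, by simpa [hĒ_def] using energyLe_datumState i₀ X₀⟩
    | succ N ih =>
        obtain ⟨z, hz, hzB⟩ := ih
        obtain ⟨z', hz', -, hz'B⟩ := h.deflate hE hq hz hzB
        refine ⟨z', hz', ?_⟩
        simpa [hq_def, pow_succ, div_div] using hz'B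
  obtain ⟨N, hN⟩ := pow_unbounded_of_one_lt Ē hq2
  obtain ⟨z, hz, hzB⟩ := key N
  obtain ⟨z', -, hone, hz'B⟩ := h.deflate hE hq hz hzB
  have hle : (1 : ℝ) ≤ Ē / (q ^ 2) ^ N / q ^ 2 := by
    have := hz'B {(i₀, (0 : ℤ))}
    simpa [hone, hq_def] using this
  have hlt : Ē / (q ^ 2) ^ N / q ^ 2 < 1 := by
    rw [div_div, div_lt_one (by positivity)]
    calc Ē < (q ^ 2) ^ N := hN
      _ ≤ (q ^ 2) ^ N * q ^ 2 := le_mul_of_one_le_right (by positivity) hq2.le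
  linarith

/-- The slack/floor incompatibility in the cell's reading: for `ε₀ > 0`, `σ > 0` and `(1+ε₀)^{θ₀} < 1+σ` one has `(1+σ)(1+ε₀)^{-θ₀} > 1` (so
`not_robustHoppingOn_of_deflation` applies; with the cell's `σ = θ₀ = 1/4` this is every `ε₀ < (5/4)^4 - 1`). [cite: Tao2016AveragedNS, §6.4 (ratio floor); cell
certificate format v2, TRANSFER-CONSTANTS §1] -/
theorem one_lt_slack_mul_floor {σ ε₀ θ₀ : ℝ} (hε : 0 < ε₀) (hσθ : (1 + ε₀) ^ θ₀ < 1 + σ) :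
    1 < (1 + σ) * (1 + ε₀) ^ (-θ₀) := by
  have h1 : 0 < (1 + ε₀) ^ θ₀ := Real.rpow_pos_of_pos (by linarith) θ₀
  rw [Real.rpow_neg (by linarith), ← div_eq_mul_inv, lt_div_iff₀ h1, one_mul]
  exact hσθ


/-! ## L-E holds: energy non-increase along exact flows (cancelling table, nearest-neighbour slot-closed `𝕊`, `ε₀ > 0`) -/

/-- Re-indexing a block of shells `K, …, K+L-1` (all modes) as an embedding `(i, k) ↦ (i, K + k)`. [cite: Tao2016AveragedNS, §4 (4.3); cell certificate format v2] -/
def blockEmb (m : ℕ) (K : ℤ) : (Fin m × ℕ) ↪ (Fin m × ℤ) :=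
  ⟨fun q => (q.1, K + (q.2 : ℤ)), by
    intro q q' hqq'
    simp only [Prod.mk.injEq] at hqq'
    exact Prod.ext hqq'.1 (by exact_mod_cast (add_left_cancel hqq'.2))⟩

/-- Block sums `∑_{k<L} ∑_i G_{i,K+k}` as sums over the re-indexed finset. [cite: Tao2016AveragedNS, §4 (4.3)] -/
theorem sum_block_eq (G : Fin m → ℤ → ℝ) (K : ℤ) (L : ℕ) :
    ∑ k ∈ Finset.range L, ∑ i, G i (K + k) =
      ∑ p ∈ ((Finset.univ : Finset (Fin m)) ×ˢ Finset.range L).map (blockEmb m K), G p.1 p.2 := by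
  rw [Finset.sum_map, Finset.sum_product, Finset.sum_comm]
  rfl

/-- **L-E PROVED.** On a nearest-neighbour slot-closed shift set, at `ε₀ > 0`, for a cancelling table, a bound on all partial sums of `S₀²` persists along every
exact format flow: every finite set of shells lies above some bond `K-1 | K`, the energy above that bond is fed only through it
(`pseudoFlowOnShift_tail_energy_le`), and the bottom flux is `≤ (1+ε₀)^{5(K-1)/2} M'^3 ∑|α| → 0` as `K → -∞` by the a-priori amplitude bound. [cite:
Tao2016AveragedNS, §4 Lemma 4.1 (4.5), (4.9)–(4.10) with (4.3)] -/
theorem exactEnergyNonincreasingOn_of_cancelling {𝕊 : Finset (ℤ × ℤ × ℤ)} {ε₀ : ℝ}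
    {α : Fin m → Fin m → Fin m → ℤ × ℤ × ℤ → ℝ}
    (h𝕊 : IsNearestNeighbourSet 𝕊) (h𝕊c : IsSlotClosed 𝕊) (hε : 0 < ε₀) (hα : IsCancellingCoeffOn 𝕊 α) :
    ExactEnergyNonincreasingOn 𝕊 ε₀ α := by
  intro τ B S₀ S F hB h s hs t
  show ∑ p ∈ t, S p.1 p.2 s ^ 2 ≤ B
  have hB0 : 0 ≤ B := by simpa using hB ∅
  rcases eq_or_lt_of_le hs.1 with h0 | hspos
  · have ht : ∀ p ∈ t, S p.1 p.2 s ^ 2 = S₀ p.1 p.2 ^ 2 := fun p _ => by rw [← h0, h.init_S]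
    rw [Finset.sum_congr rfl ht]
    exact hB t
  have hτ : 0 < τ := hspos.trans_le hs.2
  have hq : 0 < 1 + ε₀ := by linarith
  refine le_of_forall_pos_le_add fun δ hδ => ?_
  -- uniform amplitude bound from (4.5)
  obtain ⟨M, hM⟩ := h.apriori_S
  set M' : ℝ := max M 0 with hM'
  have hM'0 : 0 ≤ M' := le_max_right _ _
  have hSle : ∀ u ∈ Icc 0 τ, ∀ (i : Fin m) (k : ℤ), |S i k u| ≤ M' := by
    intro u hu i k
    have hw : (1 : ℝ) ≤ 1 + (1 + ε₀) ^ ((10 : ℝ) * k) :=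
      le_add_of_nonneg_right (Real.rpow_pos_of_pos hq _).le
    have h1 : |S i k u| ≤ (1 + (1 + ε₀) ^ ((10 : ℝ) * k)) * |S i k u| :=
      le_mul_of_one_le_left (abs_nonneg _) hw
    exact (h1.trans (hM u hu i k)).trans (le_max_left _ _)
  set C : ℝ := coeffAbsOn (botShifts 𝕊) α with hCdef
  have hC : 0 ≤ C := coeffAbsOn_nonneg _ _
  have hA : 0 ≤ M' ^ 3 * C := mul_nonneg (pow_nonneg hM'0 3) hC
  -- a depth `n` with `((1+ε₀)⁻¹)^n (M'^3 C τ) ≤ δ/2`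
  have hbinv : (1 + ε₀)⁻¹ < 1 := inv_lt_one_of_one_lt₀ (by linarith)
  have hbinv0 : 0 < (1 + ε₀)⁻¹ := inv_pos.mpr hq
  have hden : 0 < M' ^ 3 * C * τ + 1 := by
    have : 0 ≤ M' ^ 3 * C * τ := mul_nonneg hA hτ.le
    linarith
  obtain ⟨n, hn⟩ := exists_pow_lt_of_lt_one (div_pos (half_pos hδ) hden) hbinv
  -- the bottom shell `K`: below every shell of `t`, and `K - 1 ≤ -n`
  set K : ℤ := min (-(∑ p ∈ t, |p.2|)) (1 - (n : ℤ)) with hKdef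
  have hKt : ∀ p ∈ t, K ≤ p.2 := by
    intro p hp
    have h1 : |p.2| ≤ ∑ q ∈ t, |q.2| :=
      Finset.single_le_sum (f := fun q : Fin m × ℤ => |q.2|) (fun q _ => abs_nonneg _) hp
    have h2 : -|p.2| ≤ p.2 := neg_abs_le _
    have h3 : K ≤ -(∑ q ∈ t, |q.2|) := min_le_left _ _
    linarith
  have hKn : K - 1 ≤ -(n : ℤ) := by
    have h3 : K ≤ 1 - (n : ℤ) := min_le_right _ _
    linarith
  -- a block length `L` covering `t`
  set L : ℕ := ∑ p ∈ t, (p.2 - K).toNat + 1 with hLdef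
  have hsub : t ⊆ ((Finset.univ : Finset (Fin m)) ×ˢ Finset.range L).map (blockEmb m K) := by
    intro p hp
    rw [Finset.mem_map]
    refine ⟨(p.1, (p.2 - K).toNat),
      Finset.mem_product.mpr ⟨Finset.mem_univ _, Finset.mem_range.mpr ?_⟩, ?_⟩
    · have : (p.2 - K).toNat ≤ ∑ q ∈ t, (q.2 - K).toNat :=
        Finset.single_le_sum (f := fun q : Fin m × ℤ => (q.2 - K).toNat) (fun q _ => Nat.zero_le _) hp
      omega
    · show (p.1, K + ((p.2 - K).toNat : ℤ)) = p
      have h3 : ((p.2 - K).toNat : ℤ) = p.2 - K := Int.toNat_of_nonneg (by linarith [hKt p hp])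
      rw [h3, show K + (p.2 - K) = p.2 by ring]
  -- start energies over every block above `K - 1 | K` are `≤ B/2`
  have hE₀ : ∀ L' : ℕ, ∑ k ∈ Finset.range L', ∑ i, (1 / 2) * S₀ i (K + k) ^ 2 ≤ B / 2 := by
    intro L'
    have e := sum_block_eq (fun i k => S₀ i k ^ 2) K L'
    have h1 : ∑ k ∈ Finset.range L', ∑ i, S₀ i (K + k) ^ 2 ≤ B := by rw [e]; exact hB _
    have h2 : ∑ k ∈ Finset.range L', ∑ i, (1 / 2) * S₀ i (K + k) ^ 2 =
        (1 / 2) * ∑ k ∈ Finset.range L', ∑ i, S₀ i (K + k) ^ 2 := by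
      simp_rw [Finset.mul_sum]
    rw [h2]
    linarith
  -- the tail energy cap at time `s`
  have htail := GappedFrontRobustOn.pseudoFlowOnShift_tail_energy_le h𝕊 h𝕊c h hτ hε hα K hE₀ L hs
  -- the bottom flux integral is `≤ δ/2`
  have hflux : ∫ u in (0 : ℝ)..s, botSumOn 𝕊 ε₀ α S (K - 1) u ≤ δ / 2 := by
    have hle : ∀ u ∈ Set.uIoc (0 : ℝ) s,
        ‖botSumOn 𝕊 ε₀ α S (K - 1) u‖ ≤ (1 + ε₀) ^ ((5 : ℝ) * ((K - 1 : ℤ) : ℝ) / 2) * M' ^ 3 * C := by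
      intro u hu
      rw [uIoc_of_le hs.1] at hu
      have hu' : u ∈ Icc 0 τ := ⟨hu.1.le, hu.2.trans hs.2⟩
      rw [Real.norm_eq_abs]
      exact abs_botSumOn_le_of_abs_le h𝕊 ε₀ hq α S (K - 1) u hM'0
        (fun i => ⟨hSle u hu' i (K - 1), hSle u hu' i (K - 1 + 1)⟩)
    have h1 := intervalIntegral.norm_integral_le_of_norm_le_const hle
    rw [Real.norm_eq_abs, sub_zero, abs_of_nonneg hs.1] at h1
    have hpow : (1 + ε₀) ^ ((5 : ℝ) * ((K - 1 : ℤ) : ℝ) / 2) ≤ ((1 + ε₀)⁻¹) ^ n := by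
      have hK' : ((K - 1 : ℤ) : ℝ) ≤ -(n : ℝ) := by exact_mod_cast hKn
      have hn0 : (0 : ℝ) ≤ n := Nat.cast_nonneg n
      have h3 : (5 : ℝ) * ((K - 1 : ℤ) : ℝ) / 2 ≤ -(n : ℝ) := by linarith
      calc (1 + ε₀) ^ ((5 : ℝ) * ((K - 1 : ℤ) : ℝ) / 2) ≤ (1 + ε₀) ^ (-(n : ℝ)) :=
            Real.rpow_le_rpow_of_exponent_le (by linarith) h3
        _ = ((1 + ε₀)⁻¹) ^ n := by rw [Real.rpow_neg hq.le, Real.rpow_natCast, inv_pow]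
    have hstep1 : (1 + ε₀) ^ ((5 : ℝ) * ((K - 1 : ℤ) : ℝ) / 2) * M' ^ 3 * C * s ≤
        ((1 + ε₀)⁻¹) ^ n * (M' ^ 3 * C) * τ := by
      have h4 : (1 + ε₀) ^ ((5 : ℝ) * ((K - 1 : ℤ) : ℝ) / 2) * (M' ^ 3 * C) ≤
          ((1 + ε₀)⁻¹) ^ n * (M' ^ 3 * C) := mul_le_mul_of_nonneg_right hpow hA
      have h5 : 0 ≤ ((1 + ε₀)⁻¹) ^ n * (M' ^ 3 * C) := mul_nonneg (pow_nonneg hbinv0.le n) hA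
      calc (1 + ε₀) ^ ((5 : ℝ) * ((K - 1 : ℤ) : ℝ) / 2) * M' ^ 3 * C * s
          = (1 + ε₀) ^ ((5 : ℝ) * ((K - 1 : ℤ) : ℝ) / 2) * (M' ^ 3 * C) * s := by ring
        _ ≤ ((1 + ε₀)⁻¹) ^ n * (M' ^ 3 * C) * τ := mul_le_mul h4 hs.2 hs.1 h5
    calc ∫ u in (0 : ℝ)..s, botSumOn 𝕊 ε₀ α S (K - 1) u
        ≤ |∫ u in (0 : ℝ)..s, botSumOn 𝕊 ε₀ α S (K - 1) u| := le_abs_self _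
      _ ≤ (1 + ε₀) ^ ((5 : ℝ) * ((K - 1 : ℤ) : ℝ) / 2) * M' ^ 3 * C * s := h1
      _ ≤ ((1 + ε₀)⁻¹) ^ n * (M' ^ 3 * C) * τ := hstep1
      _ = ((1 + ε₀)⁻¹) ^ n * (M' ^ 3 * C * τ) := by ring
      _ ≤ δ / 2 / (M' ^ 3 * C * τ + 1) * (M' ^ 3 * C * τ) :=
          mul_le_mul_of_nonneg_right hn.le (mul_nonneg hA hτ.le)
      _ ≤ δ / 2 := by
          rw [div_mul_eq_mul_div, div_le_iff₀ hden]
          have : 0 ≤ M' ^ 3 * C * τ := mul_nonneg hA hτ.le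
          nlinarith
  -- assemble
  have hnonneg : ∀ p ∈ ((Finset.univ : Finset (Fin m)) ×ˢ Finset.range L).map (blockEmb m K),
      p ∉ t → 0 ≤ F p.1 p.2 s := fun p _ _ => h.nonneg_F p.1 p.2 s hs
  have e := sum_block_eq (fun i k => F i k s) K L
  calc ∑ p ∈ t, S p.1 p.2 s ^ 2 ≤ ∑ p ∈ t, 2 * F p.1 p.2 s := by
        refine Finset.sum_le_sum fun p _ => ?_
        have := h.defect_lower p.1 p.2 s hs
        linarith
    _ = 2 * ∑ p ∈ t, F p.1 p.2 s := by rw [Finset.mul_sum]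
    _ ≤ 2 * ∑ p ∈ ((Finset.univ : Finset (Fin m)) ×ˢ Finset.range L).map (blockEmb m K), F p.1 p.2 s :=
        mul_le_mul_of_nonneg_left (Finset.sum_le_sum_of_subset_of_nonneg hsub hnonneg) (by norm_num)
    _ = 2 * ∑ k ∈ Finset.range L, ∑ i, F i (K + k) s := by rw [e]
    _ ≤ 2 * (B / 2 + ∫ u in (0 : ℝ)..s, botSumOn 𝕊 ε₀ α S (K - 1) u) :=
        mul_le_mul_of_nonneg_left htail (by norm_num)
    _ ≤ B + δ := by linarith [hflux]

/-- **UNCONDITIONAL: `RobustHoppingOn` fails for the graded mirror table on `S♭`** whenever `0 < ε₀` and `(1+ε₀)^{θ₀} < 1+σ` — for every datum, weights, radius,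
clocks, exponent `θ` and envelope. [cite: Tao2016AveragedNS, §6.3–6.4 (statement shape); cell certificate format v2; route TaoLadderRungTwoFlat, posited table] -/
theorem not_robustHoppingOn_mirror_flat {σ ε ε₀ : ℝ} {i₀ : Fin 2} {X₀ : Fin 2 → ℝ} {w : ℤ → ℝ}
    {r θ₀ θ c₀ c : ℝ} {env₀ : ℤ → ℝ} (hε : 0 < ε₀) (hσθ : (1 + ε₀) ^ θ₀ < 1 + σ) :
    ¬ RobustHoppingOn shiftSetFlat σ ε₀ i₀ (mirrorTable ε ε) X₀ w r θ₀ θ c₀ c env₀ :=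
  not_robustHoppingOn_of_deflation
    (exactEnergyNonincreasingOn_of_cancelling isNearestNeighbourSet_shiftSetFlat isSlotClosed_shiftSetFlat hε
      (isCancellingCoeffOn_mirrorTable ε ε))
    (one_lt_slack_mul_floor hε hσθ)

/-- **The cell's constants**: with `σ = θ₀ = 1/4` (TRANSFER-CONSTANTS §1) `RobustHoppingOn` fails for the graded mirror table on `S♭` at EVERY `0 < ε₀ ≤ 1`, every
datum, weights, radius, clocks, `θ`, envelope. [cite: Tao2016AveragedNS, §6.3–6.4 (statement shape); cell certificate format v2, TRANSFER-CONSTANTS §1] -/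
theorem not_robustHoppingOn_mirror_flat_cell {ε ε₀ : ℝ} {i₀ : Fin 2} {X₀ : Fin 2 → ℝ} {w : ℤ → ℝ}
    {r θ c₀ c : ℝ} {env₀ : ℤ → ℝ} (hε : 0 < ε₀) (hε1 : ε₀ ≤ 1) :
    ¬ RobustHoppingOn shiftSetFlat (1 / 4) ε₀ i₀ (mirrorTable ε ε) X₀ w r (1 / 4) θ c₀ c env₀ := by
  refine not_robustHoppingOn_mirror_flat hε ?_
  have hlt : 1 + ε₀ < (5 / 4 : ℝ) ^ (4 : ℕ) := by norm_num; linarith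
  have h1 := Real.rpow_lt_rpow (by linarith) hlt (by norm_num : (0 : ℝ) < 1 / 4)
  have h2 : ((5 / 4 : ℝ) ^ (4 : ℕ)) ^ ((1 : ℝ) / 4) = 5 / 4 := by
    rw [show ((1 : ℝ) / 4) = ((4 : ℕ) : ℝ)⁻¹ by norm_num]
    exact Real.pow_rpow_inv_natCast (by norm_num) (by norm_num)
  rw [h2] at h1
  linarith

/-! ## The replacement packaging: hop INTO a described tube (`ρ = 0`) -/

/-- **TUBE HOPPING** = the format-v2 clauses for a DESCRIBED reference set `Z` with the step asked to land IN `Z` (membership of the re-centred state; no `ρ`-ball,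
no closure under alternative legal re-centrings): signs, weights `≥ 1`, datum in `Z`, the three static tail/tameness clauses for `Z`, existence of exact flows
on `[0, c]` from the `r`-ball around `Z`, and from every such flow of duration `≥ c₀` a core step whose re-centred state is in `Z`, with slack `σ`. [cite:
Tao2016AveragedNS, §6.3–6.4 Props. 6.4–6.5 (statement shape); cell certificate format v2] -/
def TubeHoppingOn (𝕊 : Finset (ℤ × ℤ × ℤ)) (σ ε₀ : ℝ) (i₀ : Fin m)
    (α : Fin m → Fin m → Fin m → ℤ × ℤ × ℤ → ℝ) (X₀ : Fin m → ℝ) (Z : Set (Fin m → ℤ → ℝ))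
    (w : ℤ → ℝ) (r θ₀ θ c₀ c : ℝ) (env₀ : ℤ → ℝ) : Prop :=
  0 < r ∧ 0 ≤ θ₀ ∧ θ₀ < θ ∧ θ ≤ 1 / 2 ∧ 0 < c₀ ∧ c₀ < c ∧ 0 < σ ∧ (∀ k, 1 ≤ w k) ∧
    datumState i₀ X₀ ∈ Z ∧ TailFat ε₀ Z w r ∧ TameBehind ε₀ Z w ∧ TailCompat ε₀ Z w r env₀ ∧
    (∀ S₀ : Fin m → ℤ → ℝ, ballDesc Z w r S₀ (fun i k => (1 / 2) * S₀ i k ^ 2) →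
      ∃ S F : Fin m → ℤ → ℝ → ℝ,
        PseudoFlowOnShift 𝕊 c ε₀ α 0 0 S₀ (fun i k => (1 / 2) * S₀ i k ^ 2) (fun _ _ => 0) S F) ∧
    ∀ (S₀ : Fin m → ℤ → ℝ) (τ : ℝ) (S F : Fin m → ℤ → ℝ → ℝ),
      ballDesc Z w r S₀ (fun i k => (1 / 2) * S₀ i k ^ 2) → c₀ ≤ τ →
        PseudoFlowOnShift 𝕊 τ ε₀ α 0 0 S₀ (fun i k => (1 / 2) * S₀ i k ^ 2) (fun _ _ => 0) S F →
          ∃ τ₁ a : ℝ, StepCore ε₀ θ₀ c₀ i₀ env₀ S F τ₁ a ∧ (fun i k => S i (1 + k) τ₁ / a) ∈ Z ∧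
            (1 + σ) * a ≤ |S i₀ 1 τ₁|

/-- **`TubeHoppingOn Z` ⇒ format-v2 gap data with that `Z` and `ρ := 0`.** [cite: Tao2016AveragedNS, §6.3–6.4 Props. 6.4–6.5 (statement shape); cell certificate
format v2] -/
theorem tubeHoppingOn_gapData₂On {𝕊 : Finset (ℤ × ℤ × ℤ)} {σ ε₀ : ℝ} {i₀ : Fin m}
    {α : Fin m → Fin m → Fin m → ℤ × ℤ × ℤ → ℝ} {X₀ : Fin m → ℝ} {Z : Set (Fin m → ℤ → ℝ)}
    {w : ℤ → ℝ} {r θ₀ θ c₀ c : ℝ} {env₀ : ℤ → ℝ}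
    (h : TubeHoppingOn 𝕊 σ ε₀ i₀ α X₀ Z w r θ₀ θ c₀ c env₀) :
    GapData₂On 𝕊 σ ε₀ i₀ α X₀ Z w r 0 θ₀ θ c₀ c env₀ := by
  obtain ⟨hr, hθ0, hθ, hθh, hc0, hc, hσ, hw, hdat, hfat, htame, hcompat, hexist, hstep⟩ := h
  have hstep' : ∀ (S₀ : Fin m → ℤ → ℝ) (τ : ℝ) (S F : Fin m → ℤ → ℝ → ℝ),
      ballDesc Z w r S₀ (fun i k => (1 / 2) * S₀ i k ^ 2) → c₀ ≤ τ →
        PseudoFlowOnShift 𝕊 τ ε₀ α 0 0 S₀ (fun i k => (1 / 2) * S₀ i k ^ 2) (fun _ _ => 0) S F →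
          ∃ τ₁ a : ℝ, StepTo ε₀ θ₀ c₀ i₀ (ballDesc Z w (0 * r)) (epochEnvelope env₀) S F τ₁ a ∧
            (1 + σ) * a ≤ |S i₀ 1 τ₁| := by
    intro S₀ τ S F hball hτ hflow
    obtain ⟨τ₁, a, ⟨h1, h2, h3, h4, h5, -, h7⟩, hmem, hslack⟩ := hstep S₀ τ S F hball hτ hflow
    exact ⟨τ₁, a, ⟨h1, h2, h3, h4, h5, ballDesc_of_mem hmem (by simp) _, h7⟩, hslack⟩
  refine ⟨⟨hr, le_rfl, zero_lt_one, hθ0, hθ, hθh, hc0, hc, hw, hdat, hfat, hexist, ?_⟩, hσ, htame, hstep',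
    hcompat⟩
  intro S₀ τ S F hball hτ hflow
  obtain ⟨τ₁, a, hst, -⟩ := hstep' S₀ τ S F hball hτ hflow
  exact ⟨τ₁, a, hst⟩

end Summit.NavierStokesRegularity.NavierStokesRegularity.Theorems.ReachClosure

end
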